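import Summits.Ventures.PercRepro.C025ProfileGirthHallSuccB

/-!
# THE HALL FORM OF THE ROW `(q, q+1)` AT GIRTH `≥ q + 1` — PART C: THE DEMAND SIDE (night-3 g18)

With the weights of part B (`W`, `wgt`, `t` described by hypotheses), every rank-`q` set `B` collects at least its price
`ρ(E ∖ B)/(q+1) ≤ (min(q, N_B − |B|) + m_B)/(q+1)` (`price_succ_le_pbar`):
* `|B| = q`: the `m_B` sets `B ∪ {y}` (`y ∉ cl B`) give `1/(q+1)` each and the `(N_B − q) · m_B` sets `B ∪ {x, y}` (`x ∈ cl B ∖ B`,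
  `y ∉ cl B`) give `1/((q+1) m_B)` each — total `(n − q)/(q+1)`;
* `|B| = q + 1`: the `m_B` sets `B ∪ {y}` give `1 − 1/m_B` each, and when `m_B = 2`, `N_B ≥ 2q + 1` the `2 (N_B − q − 1)` sets
  `B ∪ {z, y}` give `t_B` each — total `m_B − 1 + [cond]/(q+1)`;
* `|B| = q + 2`: `m_B · wgt(B)`; `|B| ≥ q + 3`: `m_B`.
**`dem_of_weights`**.  No `def`, no `instance`, no notation.  Axioms: standard.
-/

open scoped Matroid

namespace PercRepro

open Set Finset ThmH Staged

namespace GirthRows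

variable {α : Type} [DecidableEq α] {M : Matroid α} [M.Finite]

open scoped Classical

/-- `B ∪ {y}` for `y ∉ cl B` is a rank-`(q+1)` set containing `B`, with `cnt(B, B ∪ {y}) = 0`. -/
theorem insert_out_facts {q : ℕ} {B : Finset α} (hB : B ∈ Profile.Rq M q) {y : α}
    (hy : y ∈ (gr M).filter (fun x => x ∉ M.closure (B : Set α))) :
    insert y B ∈ (Shadow.levelSet M (q + 1)).filter (fun S => B ⊆ S) ∧ (insert y B).card = B.card + 1 ∧
      ((insert y B \ B).filter (fun x => x ∈ M.closure (B : Set α))).card = 0 := by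
  have hyB : y ∉ B := notMem_of_mem_out (Profile.mem_Rq.1 hB).1 hy
  rw [Finset.mem_filter] at hy
  refine ⟨?_, Finset.card_insert_of_notMem hyB, ?_⟩
  · rw [Finset.mem_filter]
    exact ⟨insert_mem_levelSet_of_out hB (Finset.mem_filter.2 hy), Finset.subset_insert y B⟩
  · rw [Finset.card_eq_zero, Finset.filter_eq_empty_iff]
    intro x hx
    rw [Finset.mem_sdiff, Finset.mem_insert] at hx
    rcases hx.1 with rfl | hxB
    · exact hy.2
    · exact absurd hxB hx.2

/-- `B ∪ {x, y}` for `x ∈ cl B ∖ B`, `y ∉ cl B` is a rank-`(q+1)` set containing `B`, of `|B| + 2` points, with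
`cnt(B, B ∪ {x, y}) = 1`. -/
theorem insert_two_facts {q : ℕ} {B : Finset α} (hB : B ∈ Profile.Rq M q) {x : α}
    (hx : x ∈ (gr M).filter (fun z => z ∈ M.closure (B : Set α)) \ B) {y : α}
    (hy : y ∈ (gr M).filter (fun z => z ∉ M.closure (B : Set α))) :
    insert y (insert x B) ∈ (Shadow.levelSet M (q + 1)).filter (fun S => B ⊆ S) ∧
      (insert y (insert x B)).card = B.card + 2 ∧
      ((insert y (insert x B) \ B).filter (fun z => z ∈ M.closure (B : Set α))).card = 1 := by
  obtain ⟨hXq, hXF, hXO⟩ := insert_mem_of_mem_closureF hB hx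
  have hxB : x ∉ B := (Finset.mem_sdiff.1 hx).2
  have hxc : x ∈ M.closure (B : Set α) := (Finset.mem_filter.1 (Finset.mem_sdiff.1 hx).1).2
  have hy' : y ∈ (gr M).filter (fun z => z ∉ M.closure ((insert x B : Finset α) : Set α)) := by rw [hXO]; exact hy
  have hyX : y ∉ insert x B := notMem_of_mem_out (Profile.mem_Rq.1 hXq).1 hy'
  have hyc : y ∉ M.closure (B : Set α) := (Finset.mem_filter.1 hy).2
  refine ⟨?_, ?_, ?_⟩
  · rw [Finset.mem_filter]
    exact ⟨insert_mem_levelSet_of_out hXq hy', (Finset.subset_insert x B).trans (Finset.subset_insert y _)⟩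
  · rw [Finset.card_insert_of_notMem hyX, Finset.card_insert_of_notMem hxB]
  · rw [Finset.card_eq_one]
    refine ⟨x, ?_⟩
    ext z
    rw [Finset.mem_filter, Finset.mem_sdiff, Finset.mem_insert, Finset.mem_insert, Finset.mem_singleton]
    constructor
    · rintro ⟨⟨hz, hzB⟩, hzc⟩
      rcases hz with rfl | rfl | hzB'
      · exact absurd hzc hyc
      · rfl
      · exact absurd hzB' hzB
    · rintro rfl
      exact ⟨⟨Or.inr (Or.inl rfl), hxB⟩, hxc⟩

/-- **The demand side of the certificate.** -/
theorem dem_of_weights {q : ℕ} (hq : 2 ≤ q) (hrank : ((q + 2 : ℕ) : ℕ∞) ≤ M.eRank)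
    (W : Finset α → Finset α → ℚ) (wgt : Finset α → ℚ) (t : Finset α → ℚ)
    (hnn : ∀ B S, 0 ≤ W B S)
    (hw1 : ∀ B : Finset α, B.card = q + 1 →
      wgt B = 1 - 1 / (((gr M).filter (fun x => x ∉ M.closure (B : Set α))).card : ℚ))
    (hw2 : ∀ B : Finset α, B.card = q + 2 → ((gr M).filter (fun x => x ∉ M.closure (B : Set α))).card = 2 →
      2 * q + 1 ≤ ((gr M).filter (fun x => x ∈ M.closure (B : Set α))).card → wgt B = 1 - ((q : ℚ) + 2) * t B)
    (hw3 : ∀ B : Finset α, B.card = q + 2 → ¬ (((gr M).filter (fun x => x ∉ M.closure (B : Set α))).card = 2 ∧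
      2 * q + 1 ≤ ((gr M).filter (fun x => x ∈ M.closure (B : Set α))).card) → wgt B = 1)
    (hw5 : ∀ B : Finset α, q + 3 ≤ B.card → wgt B = 1)
    (ht : ∀ B : Finset α, t B = 1 / (2 * ((q : ℚ) + 1) *
      ((((gr M).filter (fun x => x ∈ M.closure (B : Set α))).card - q - 1 : ℕ) : ℚ)))
    (h1 : ∀ B S : Finset α, B ⊆ S → B.card = q → S.card = q + 1 → W B S = 1 / ((q : ℚ) + 1))
    (h2 : ∀ B S : Finset α, B ⊆ S → B.card = q → S.card = q + 2 →
      ((S \ B).filter (fun x => x ∈ M.closure (B : Set α))).card = 1 →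
      W B S = 1 / (((q : ℚ) + 1) * (((gr M).filter (fun x => x ∉ M.closure (B : Set α))).card : ℚ)))
    (h3 : ∀ B S : Finset α, B ⊆ S → q + 1 ≤ B.card → S.card = B.card + 1 →
      ((S \ B).filter (fun x => x ∈ M.closure (B : Set α))).card = 0 → W B S = wgt B)
    (h4 : ∀ B S : Finset α, B ⊆ S → B.card = q + 1 →
      ((gr M).filter (fun x => x ∉ M.closure (B : Set α))).card = 2 →
      2 * q + 1 ≤ ((gr M).filter (fun x => x ∈ M.closure (B : Set α))).card → S.card = q + 3 →
      ((S \ B).filter (fun x => x ∈ M.closure (B : Set α))).card = 1 → W B S = t B) :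
    ∀ B ∈ Profile.Rq M q, Profile.price M q (q + 1) B ≤
      ∑ S ∈ (Shadow.levelSet M (q + 1)).filter (fun S => B ⊆ S), W B S := by
  intro B hB
  obtain ⟨hBg, hBr'⟩ := Profile.mem_Rq.1 hB
  have hBr : rkN M B = q := Staged.rkN_eq_iff.2 hBr'
  set O := (gr M).filter (fun x => x ∉ M.closure (B : Set α)) with hO
  set F := (gr M).filter (fun x => x ∈ M.closure (B : Set α)) with hF
  set m := O.card with hm
  set N := F.card with hN
  set k := B.card with hk
  have hm2 : 2 ≤ m := two_le_card_out hrank hBr'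
  have hkN : k ≤ N := card_le_card_closureF hBg
  have hBF : B ⊆ F := by
    intro x hx
    rw [hF, Finset.mem_filter]
    have hBE : (B : Set α) ⊆ M.E := by rw [← coe_gr]; exact_mod_cast hBg
    exact ⟨hBg hx, M.subset_closure (B : Set α) hBE (Finset.mem_coe.2 hx)⟩
  have hkq : q ≤ k := by have := Staged.rkN_le_card (M := M) B; omega
  have hpr := price_succ_le_pbar hB
  have hq' : (2 : ℚ) ≤ q := by exact_mod_cast hq
  have hpos : (0 : ℚ) < (q : ℚ) + 1 := by positivity
  have hmq : (0 : ℚ) < m := by exact_mod_cast (by omega : 0 < m)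
  set T1 := O.image (fun y => insert y B) with hT1
  have hT1inj : Set.InjOn (fun y => insert y B) (O : Set α) := by
    intro y hy y' hy' hyy'
    simp only at hyy'
    have hyB : y ∉ B := notMem_of_mem_out hBg (Finset.mem_coe.1 hy)
    have hmem : y ∈ insert y' B := hyy' ▸ Finset.mem_insert_self y B
    rcases Finset.mem_insert.1 hmem with h | h
    · exact h
    · exact absurd h hyB
  have hT1card : T1.card = m := by rw [hT1, Finset.card_image_of_injOn hT1inj]
  have hT1sub : T1 ⊆ (Shadow.levelSet M (q + 1)).filter (fun S => B ⊆ S) := by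
    rw [hT1, Finset.image_subset_iff]
    intro y hy
    exact (insert_out_facts hB hy).1
  set T2 := ((F \ B) ×ˢ O).image (fun p => insert p.2 (insert p.1 B)) with hT2
  have hT2inj : Set.InjOn (fun p : α × α => insert p.2 (insert p.1 B)) (((F \ B) ×ˢ O : Finset (α × α)) : Set (α × α)) := by
    intro p hp p' hp' hpp'
    simp only at hpp'
    rw [Finset.mem_coe, Finset.mem_product] at hp hp'
    -- the points in cl B and outside are distinguished by the closure
    have key : ∀ (a b : α × α), a ∈ (F \ B) ×ˢ O → b ∈ (F \ B) ×ˢ O →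
        insert a.2 (insert a.1 B) = insert b.2 (insert b.1 B) → a.1 = b.1 ∧ a.2 = b.2 := by
      intro a b ha hb hab
      rw [Finset.mem_product] at ha hb
      have ha1 := Finset.mem_sdiff.1 ha.1
      have hb1 := Finset.mem_sdiff.1 hb.1
      have ha1c : a.1 ∈ M.closure (B : Set α) := (Finset.mem_filter.1 ha1.1).2
      have hb1c : b.1 ∈ M.closure (B : Set α) := (Finset.mem_filter.1 hb1.1).2
      have ha2c : a.2 ∉ M.closure (B : Set α) := (Finset.mem_filter.1 ha.2).2
      have hb2c : b.2 ∉ M.closure (B : Set α) := (Finset.mem_filter.1 hb.2).2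
      have hBE : (B : Set α) ⊆ M.E := by rw [← coe_gr]; exact_mod_cast hBg
      have hBcl : ∀ z ∈ B, z ∈ M.closure (B : Set α) := fun z hz => M.subset_closure (B : Set α) hBE (Finset.mem_coe.2 hz)
      -- a.1 ∈ insert b.2 (insert b.1 B): a.1 = b.2 impossible (closure), a.1 ∈ B impossible
      have h1 : a.1 ∈ insert b.2 (insert b.1 B) := hab ▸ Finset.mem_insert_of_mem (Finset.mem_insert_self a.1 B)
      have h2 : a.2 ∈ insert b.2 (insert b.1 B) := hab ▸ Finset.mem_insert_self a.2 _
      rw [Finset.mem_insert, Finset.mem_insert] at h1 h2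
      constructor
      · rcases h1 with h | h | h
        · exfalso; rw [h] at ha1c; exact hb2c ha1c
        · exact h
        · exfalso; exact ha1.2 h
      · rcases h2 with h | h | h
        · exact h
        · exfalso; rw [h] at ha2c; exact ha2c hb1c
        · exfalso; exact ha2c (hBcl _ h)
    obtain ⟨e1, e2⟩ := key p p' (Finset.mem_product.2 hp) (Finset.mem_product.2 hp') hpp'
    exact Prod.ext e1 e2
  have hT2card : T2.card = (N - k) * m := by
    rw [hT2, Finset.card_image_of_injOn hT2inj, Finset.card_product, Finset.card_sdiff_of_subset hBF]
  have hT2sub : T2 ⊆ (Shadow.levelSet M (q + 1)).filter (fun S => B ⊆ S) := by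
    rw [hT2, Finset.image_subset_iff]
    intro p hp
    rw [Finset.mem_product] at hp
    exact (insert_two_facts hB hp.1 hp.2).1
  have hdisj : Disjoint T1 T2 := by
    rw [Finset.disjoint_left]
    intro S hS1 hS2
    rw [hT1, Finset.mem_image] at hS1
    rw [hT2, Finset.mem_image] at hS2
    obtain ⟨y, hy, rfl⟩ := hS1
    obtain ⟨p, hp, hpS⟩ := hS2
    rw [Finset.mem_product] at hp
    have c1 := (insert_out_facts hB hy).2.1
    have c2 := (insert_two_facts hB hp.1 hp.2).2.1
    rw [hpS] at c2
    omega
  -- the total over T1 ∪ T2 is a lower bound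
  have hlow : ∑ S ∈ T1, W B S + ∑ S ∈ T2, W B S ≤
      ∑ S ∈ (Shadow.levelSet M (q + 1)).filter (fun S => B ⊆ S), W B S := by
    rw [← Finset.sum_union hdisj]
    apply Finset.sum_le_sum_of_subset_of_nonneg (Finset.union_subset hT1sub hT2sub)
    intro S _ _
    exact hnn B S
  -- the values on T1
  rcases Nat.lt_or_ge k (q + 1) with hkq' | hk1
  · -- k = q
    have hkq : k = q := by omega
    have hv1 : ∑ S ∈ T1, W B S = (m : ℚ) * (1 / ((q : ℚ) + 1)) := by
      rw [hT1, Finset.sum_image hT1inj]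
      have : ∀ y ∈ O, W B (insert y B) = 1 / ((q : ℚ) + 1) := by
        intro y hy
        have hf := insert_out_facts hB hy
        exact h1 B _ (Finset.subset_insert y B) hkq (by rw [hf.2.1]; omega)
      rw [Finset.sum_congr rfl this, Finset.sum_const, nsmul_eq_mul]
    have hv2 : ∑ S ∈ T2, W B S = (((N - k) * m : ℕ) : ℚ) * (1 / (((q : ℚ) + 1) * (m : ℚ))) := by
      rw [hT2, Finset.sum_image hT2inj]
      have : ∀ p ∈ (F \ B) ×ˢ O, W B (insert p.2 (insert p.1 B)) = 1 / (((q : ℚ) + 1) * (m : ℚ)) := by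
        intro p hp
        rw [Finset.mem_product] at hp
        have hf := insert_two_facts hB hp.1 hp.2
        exact h2 B _ ((Finset.subset_insert _ B).trans (Finset.subset_insert _ _)) hkq (by rw [hf.2.1]; omega) hf.2.2
      rw [Finset.sum_congr rfl this, Finset.sum_const, nsmul_eq_mul, Finset.card_product, Finset.card_sdiff_of_subset hBF]
    have hpb : Profile.price M q (q + 1) B ≤ ((N - k + m : ℕ) : ℚ) / ((q : ℚ) + 1) := by
      refine hpr.trans ?_
      apply div_le_div_of_nonneg_right _ hpos.le
      have : min q (N - k) + m ≤ N - k + m := by omega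
      exact_mod_cast this
    calc Profile.price M q (q + 1) B ≤ ((N - k + m : ℕ) : ℚ) / ((q : ℚ) + 1) := hpb
      _ = (m : ℚ) * (1 / ((q : ℚ) + 1)) + (((N - k) * m : ℕ) : ℚ) * (1 / (((q : ℚ) + 1) * (m : ℚ))) := by
          push_cast
          field_simp
          ring
      _ = ∑ S ∈ T1, W B S + ∑ S ∈ T2, W B S := by rw [hv1, hv2]
      _ ≤ _ := hlow
  · -- k ≥ q + 1: the m sets B ∪ {y} give wgt B each
    have hv1 : ∑ S ∈ T1, W B S = (m : ℚ) * wgt B := by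
      rw [hT1, Finset.sum_image hT1inj]
      have : ∀ y ∈ O, W B (insert y B) = wgt B := by
        intro y hy
        have hf := insert_out_facts hB hy
        exact h3 B _ (Finset.subset_insert y B) hk1 hf.2.1 hf.2.2
      rw [Finset.sum_congr rfl this, Finset.sum_const, nsmul_eq_mul]
    have hT2nn : 0 ≤ ∑ S ∈ T2, W B S := Finset.sum_nonneg (fun S _ => hnn B S)
    rcases Nat.lt_or_ge k (q + 2) with hk2 | hk2
    · -- k = q + 1
      have hkq1 : k = q + 1 := by omega
      have hwgt := hw1 B hkq1
      by_cases hc : m = 2 ∧ 2 * q + 1 ≤ N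
      · -- the transfer sets
        have hv2 : ∑ S ∈ T2, W B S = (((N - k) * m : ℕ) : ℚ) * t B := by
          rw [hT2, Finset.sum_image hT2inj]
          have : ∀ p ∈ (F \ B) ×ˢ O, W B (insert p.2 (insert p.1 B)) = t B := by
            intro p hp
            rw [Finset.mem_product] at hp
            have hf := insert_two_facts hB hp.1 hp.2
            exact h4 B _ ((Finset.subset_insert _ B).trans (Finset.subset_insert _ _)) hkq1 hc.1 hc.2
              (by rw [hf.2.1]; omega) hf.2.2
          rw [Finset.sum_congr rfl this, Finset.sum_const, nsmul_eq_mul, Finset.card_product, Finset.card_sdiff_of_subset hBF]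
        have hpb : Profile.price M q (q + 1) B ≤ ((q : ℚ) + 2) / ((q : ℚ) + 1) := by
          refine hpr.trans ?_
          apply div_le_div_of_nonneg_right _ hpos.le
          have : min q (N - k) + m ≤ q + 2 := by omega
          exact_mod_cast this
        have hNk : (((N - k) * m : ℕ) : ℚ) * t B = 1 / ((q : ℚ) + 1) := by
          rw [ht B, hc.1]
          have hNq : ((N - q - 1 : ℕ) : ℚ) = ((N - k : ℕ) : ℚ) := by rw [hkq1]; rfl
          rw [← hF, hNq]
          have hpos' : (0 : ℚ) < ((N - k : ℕ) : ℚ) := by exact_mod_cast (by omega : 0 < N - k)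
          push_cast
          field_simp
        have hwgt' : wgt B = 1 - 1 / (m : ℚ) := hwgt
        rw [hv1, hwgt', hc.1] at hlow
        rw [hv2, hNk] at hlow
        calc Profile.price M q (q + 1) B ≤ ((q : ℚ) + 2) / ((q : ℚ) + 1) := hpb
          _ = (2 : ℚ) * (1 - 1 / (2 : ℚ)) + 1 / ((q : ℚ) + 1) := by field_simp; ring
          _ ≤ _ := by
              have : ((2 : ℕ) : ℚ) = (2 : ℚ) := by norm_num
              rw [this] at hlow
              exact hlow
      · -- no transfer: m − 1 suffices
        have hpb : Profile.price M q (q + 1) B * ((q : ℚ) + 1) ≤ ((min q (N - k) + m : ℕ) : ℚ) := by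
          rw [div_eq_mul_inv] at hpr
          have := mul_le_mul_of_nonneg_right hpr hpos.le
          rwa [mul_assoc, inv_mul_cancel₀ hpos.ne', mul_one] at this
        have hwgt' : wgt B = 1 - 1 / (m : ℚ) := hwgt
        have hcalc : (m : ℚ) * wgt B = (m : ℚ) - 1 := by
          rw [hwgt']; field_simp
        rw [hv1, hcalc] at hlow
        have hm' : (2 : ℚ) ≤ m := by exact_mod_cast hm2
        -- (min + m)/(q+1) ≤ m − 1
        have hkey : ((min q (N - k) + m : ℕ) : ℚ) ≤ ((m : ℚ) - 1) * ((q : ℚ) + 1) := by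
          rcases Nat.lt_or_ge 2 m with hm3 | hm2'
          · have : min q (N - k) + m ≤ q + m := by omega
            have hb : ((min q (N - k) + m : ℕ) : ℚ) ≤ (q : ℚ) + m := by exact_mod_cast this
            have hm3' : (3 : ℚ) ≤ m := by exact_mod_cast hm3
            nlinarith
          · have hm2'' : m = 2 := by omega
            have hN2 : N ≤ 2 * q := by
              by_contra hN
              exact hc ⟨hm2'', by omega⟩
            have : min q (N - k) + m ≤ q + 1 := by omega
            have hb : ((min q (N - k) + m : ℕ) : ℚ) ≤ (q : ℚ) + 1 := by exact_mod_cast this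
            have hm2q : (m : ℚ) = 2 := by exact_mod_cast hm2''
            rw [hm2q]; linarith
        have : Profile.price M q (q + 1) B ≤ (m : ℚ) - 1 := by
          have h := hpb.trans hkey
          exact le_of_mul_le_mul_right h hpos
        linarith
    · -- k ≥ q + 2: m · wgt B ≥ price
      have hpb : Profile.price M q (q + 1) B * ((q : ℚ) + 1) ≤ ((min q (N - k) + m : ℕ) : ℚ) := by
        rw [div_eq_mul_inv] at hpr
        have := mul_le_mul_of_nonneg_right hpr hpos.le
        rwa [mul_assoc, inv_mul_cancel₀ hpos.ne', mul_one] at this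
      have hb : ((min q (N - k) + m : ℕ) : ℚ) ≤ (q : ℚ) + m := by
        have : min q (N - k) + m ≤ q + m := by omega
        exact_mod_cast this
      have hm' : (2 : ℚ) ≤ m := by exact_mod_cast hm2
      rw [hv1] at hlow
      have hwgt_ge : (q : ℚ) + m ≤ (m : ℚ) * wgt B * ((q : ℚ) + 1) := by
        rcases Nat.lt_or_ge k (q + 3) with hk3 | hk3
        · have hkq2 : k = q + 2 := by omega
          by_cases hc : m = 2 ∧ 2 * q + 1 ≤ N
          · rw [hw2 B hkq2 hc.1 hc.2, ht B, hc.1, ← hF]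
            push_cast
            have hDpos : (0 : ℚ) < ((F.card - q - 1 : ℕ) : ℚ) := by
              exact_mod_cast (by omega : 0 < F.card - q - 1)
            have hqD : (q : ℚ) + 2 ≤ ((F.card - q - 1 : ℕ) : ℚ) * q := by
              have : q + 2 ≤ (F.card - q - 1) * q := by
                have h3 : q ≤ F.card - q - 1 := by omega
                nlinarith
              exact_mod_cast this
            set D : ℚ := ((F.card - q - 1 : ℕ) : ℚ) with hD
            have h1 : ((q : ℚ) + 2) / D ≤ q := by rw [div_le_iff₀ hDpos]; linarith
            have h2 : (2 : ℚ) * (1 - ((q : ℚ) + 2) * (1 / (2 * ((q : ℚ) + 1) * D))) * ((q : ℚ) + 1) =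
                2 * ((q : ℚ) + 1) - ((q : ℚ) + 2) / D := by field_simp
            rw [h2]
            linarith
          · rw [hw3 B hkq2 hc, mul_one]
            nlinarith
        · rw [hw5 B hk3, mul_one]
          nlinarith
      have : Profile.price M q (q + 1) B ≤ (m : ℚ) * wgt B := by
        have h := hpb.trans (hb.trans hwgt_ge)
        exact le_of_mul_le_mul_right h hpos
      linarith

end GirthRows

end PercRepro
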